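/-
Copyright: the b2b-balaban T⁴-continuum CRUX team, row NE7b OWNER lineage `t4-ne7b-p1` (gen 107; v5 gen 108). Project licence.
-/
import Summits.QuantumFields.BalabanUV.T4Continuum.Spine.NE7b.ConvexWindowTiltMoment
import Summits.QuantumFields.BalabanUV.T4Continuum.Spine.NE7b.ConvexWindowVirial
import Summits.QuantumFields.BalabanUV.T4Continuum.Spine.NE7b.ConvexWindowSuppliers
import Mathlib.MeasureTheory.Function.L2Space

/-!
# THE WINDOWED CONVEXITY ROAD WITH THE CENTRING LETTER DISCHARGED: BY THE VIRIAL INEQUALITY (orthonormal directions, `0 ∈ K`: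
# `∫_K e^{−V} ≤ exp((Σ_k q_k + n·q_max)∕λ)·∫_K e^{−(V+g)}`) with its PRIMITIVE-CONSTANTS SOCKET (five numbers `σ, h, n, q_max, B`, NO
# radius), and — on MODEL windows only — BY SUPPORT (`K ⊆ B̄(0,R)`: `exp(Σ_k q_k(λ⁻¹ + R²)‖u_k‖²)`) (row NE7b, node U5c; residual (R2′)
# family (2) with its (R1″) tilted-mean letter PAID on the window; kernel ENDs)

Cell `pub-balaban`, sub-cell `t4`, spine estimate NE7b (`T4WeightBudget.RelWeightBound`; the cell's OWN estimate — NOT PRINTED in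
[Bałaban 1983–89], NOT PROVED).  Crux-route work under `Spine/NE7b/` by the row's OWNER; NOTHING of Bałaban's is named or asserted;
no `T4Continuum/Support` leaf typed; no `def`; zero `sorry`.

WHY.  The windowed road `…ConvexWindowTiltMoment.exp_moment_le_of_uniformlyConvex_on_boundedConvexWindow` displays ONE letter beyond
convexity: the windowed tilted means `m_k = ∫⟪u_k,y⟫ dν_{V,K} = ⟪u_k, m⟫`, `m = ∫ y dν_{V,K}` the windowed MEAN VECTOR.  On a window
inside a ball `B̄(0,R)` SUPPORT pays it outright (`|m_k| ≤ ‖u_k‖R`) — TRUE, but a MODEL-window device: at print's window radius it is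
DEAD BY VALUE (refuter E-ne7bref-g71-3 ∕ F449 ∕ F454 ∕ F455: the `λR²`-class summand `B·ρ²` is `10^{163…191}` nats per cube against a
budget of `10^{113}`; F443 (c) was retracted by value).  What print can afford is the dimension: the windowed
virial inequality `…ConvexWindowVirial.integral_norm_sq_windowTilted_le` gives `‖m‖² ≤ ∫‖y‖² dν_{V,K} ≤ n∕λ` for `0 ∈ K` with the
variational letter `0 ≤ ⟪∇V 0, y⟫` on `K`.  For ORTHONORMAL directions `u_k` (the spectral form of the sacrificed quadratic form
`Q = Σ_k q_k u_k u_kᵀ`, as `…ConvexTiltMoment` notes), Bessel gives `Σ_k q_k m_k² = Σ_k q_k⟪u_k,m⟫² ≤ q_max·‖m‖² ≤ q_max·n∕λ`.  NET: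
`log(∫_K e^{−V} ∕ ∫_K e^{−(V+g)}) ≤ (tr Q + n·‖Q‖)∕λ ≤ 2n·q_max∕λ` — the uncentred road costs the fibre DIMENSION `n` where the centred one
costs the RANK `r` (same order for a near region whose sacrificed form touches all its plaquettes); VALUE-FREE in the non-quadratic part.

WHAT IS PROVED ([folklore]):
* §1 centring BY SUPPORT (MODEL windows — true as mathematics, dead by value at print's radius): `ae_mem_windowTilted`,
  **`abs_windowTiltedMean_inner_le_of_subset_closedBall`** (`K ⊆ B̄(0,R)` ⟹ `|∫⟪u,x⟫dν_{V,K}| ≤ ‖u‖R`, any `V`),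
  **`exp_moment_le_of_uniformlyConvex_on_convexWindow_subset_closedBall`**: `∫_K e^{−V} ≤ exp(Σ_k q_k(λ⁻¹ + R²)‖u_k‖²)·∫_K e^{−(V+g)}` —
  letters: `K` convex measurable `⊆ B̄(0,R)`, `V` continuous λ-convex on `K`, `q ≥ 0`, NOTHING ELSE.
* §2 `norm_sq_integral_le_integral_norm_sq` (`‖∫f dν‖² ≤ ∫‖f‖² dν`, probability `ν`), **`norm_sq_windowTiltedMean_le`** (`‖∫ y dν_{V,K}‖² ≤ n∕λ`),
  **`sum_mul_sq_windowTiltedMean_le_of_orthonormal`** (`Σ_k q_k(∫⟪u_k,y⟫dν_{V,K})² ≤ q_max·n∕λ`, `0 ≤ q_k ≤ q_max`).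
* §4 **`exp_moment_le_of_quadratic_add_anharmonic_on_convexWindow`** — the support-centred END from primitive constants (MODEL
  windows): `V = ⟪x,Ax⟫ + P`, `A` σ-coercive symmetric, `P ∈ C³` anharmonic with `‖D³P‖ ≤ c₃` on `K`, `0 ∈ K ⊆ B̄(0,ρ)` convex,
  `c₃ρ < 2σ`, `q ≥ 0`: `∫_K e^{−V} ≤ exp(Σ_k q_k((2σ − c₃ρ)⁻¹ + ρ²)‖u_k‖²)·∫_K e^{−(V+g)}` (modulus from `…ConvexWindowSuppliers`).
* §5 `anharmonicWindowCarrier_le` (`Σ_k q_k‖u_k‖² ≤ B` ⟹ carrier `≤ exp(B((2σ−c₃ρ)⁻¹ + ρ²))`) and the junction BY NAME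
  **`locCondStability_of_anharmonicWindowCarrier_on_support`** (the FOUR numbers `σ, c₃, ρ, B` y-uniform per `(j, g)`,
  `b = B((2σ − c₃ρ)⁻¹ + ρ²)`) — the SUPPORT-CENTRED socket: MODEL windows only; at print's radius the `B·ρ²` summand is dead by value
  (refuter F454 ∕ F455).  The (A3) socket is the virial twin `…ConvexWindowVirialSocket`.
* THE (A3) SOCKETS live in the companions: `…ConvexWindowVirialSocket` (the VIRIAL TWIN of §4–§5, refuter ω-ne7bref-g73-1:
  `V = ⟪x,Ax⟫ + P`, Hessian-small `P` ON `K`, critical centre `DP(0) = 0`; FIVE numbers `σ, h, n, q_max, B`, NO radius) and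
  `…ConvexWindowTiltRecentred` (no centre letter: the K-argmin re-centring, `G₀ = ‖∇V 0‖` displayed; refuter κ-ne7bref-g72-1 (ii),
  σ-ne7bref-g74-1).
* §3 **`exp_moment_le_of_uniformlyConvex_on_boundedConvexWindow_orthonormal`**: `K` convex, bounded, measurable, `0 ∈ K`; `V ∈ C¹`,
  `λ`-uniformly convex ON `K`, `0 ≤ ⟪∇V 0, y⟫` on `K`; `u` orthonormal, `0 ≤ q_k ≤ q_max` (`q_max ≥ 0` displayed for `r = 0`):
  `∫_K e^{−V} ≤ exp((Σ_k q_k + n·q_max)∕λ) · ∫_K e^{−(V + Σ_k q_k⟪u_k,·⟫²)}`.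

NOT HERE (honest): which window ∕ exponent ∕ centre Bałaban's steps produce ((A1c)∕(A3) readings); the even class (cheaper: `tr Q∕λ`,
`…ConvexWindowTiltMoment` §4) and the perturbative class (`…ConvexWindowTiltedMeanShift`) remain the by-value roads when they apply;
anything of Bałaban's.  NE7b NOT PRINTED ∕ NOT PROVED; spine PROVED 0∕9; rung (B)+1 on a FINITE torus — NOT infinite volume, NOT the
mass gap, NOT Clay.
HONEST DEPENDENCY: continuum YM on T⁴ ⇐ BetaPertH ∧ nine spine estimates (0/9 proved); BetaPertH ⇐ (D1) ∧ (D4) ∧ CAP+tail.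
-/

set_option autoImplicit false

noncomputable section

open MeasureTheory Real Finset
open scoped RealInnerProductSpace
open Summit.QuantumFields.BalabanUV.T4Continuum.B16HistoryIndexedRepr Summit.QuantumFields.BalabanUV.T4Continuum.B16HistoryReprChain
open Summit.QuantumFields.BalabanUV.T4Continuum.NE7b.PrefixExtraction Summit.QuantumFields.BalabanUV.T4Continuum.NE7b.LocalConditionalStability
open Summit.QuantumFields.BalabanUV.T4Continuum.NE7b.CarrierOnSupport
open Summit.QuantumFields.BalabanUV.T4Continuum.NE7b.ConvexWindowTiltMoment
open Summit.QuantumFields.BalabanUV.T4Continuum.NE7b.ConvexWindowVirial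
open Summit.QuantumFields.BalabanUV.T4Continuum.NE7b.ConvexWindowSuppliers

namespace Summit.QuantumFields.BalabanUV.T4Continuum.NE7b.ConvexWindowTiltCentred

variable {n : ℕ}

/-! ## §1 Centring BY SUPPORT: on a window inside `B̄(0,R)` every windowed tilted mean is at most `‖u‖·R` -/

/-- The windowed tilt lives on the window: `ν_{V,K}`-almost every point lies in `K`. [folklore] -/
theorem ae_mem_windowTilted {V : EuclideanSpace ℝ (Fin n) → ℝ} {K : Set (EuclideanSpace ℝ (Fin n))} (hKm : MeasurableSet K) :
    ∀ᵐ x ∂((volume.restrict K).tilted fun x => -V x), x ∈ K :=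
  (tilted_absolutelyContinuous _ _).ae_le (ae_restrict_mem hKm)

/-- **CENTRING BY SUPPORT** (true as mathematics; a MODEL-window device — at print's window radius dead by value, refuter
E-ne7bref-g71-3 ∕ F449 ∕ F454 ∕ F455): for a measurable window `K ⊆ B̄(0, R)`, `R ≥ 0`, and ANY exponent `V`,
`|∫⟪u, x⟫ dν_{V,K}| ≤ ‖u‖·R` — no convexity, no centre, no derivative. [folklore] -/
theorem abs_windowTiltedMean_inner_le_of_subset_closedBall {V : EuclideanSpace ℝ (Fin n) → ℝ}
    {K : Set (EuclideanSpace ℝ (Fin n))} {R : ℝ} (hKm : MeasurableSet K)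
    (hKR : K ⊆ Metric.closedBall (0 : EuclideanSpace ℝ (Fin n)) R) (hR : 0 ≤ R) (u : EuclideanSpace ℝ (Fin n)) :
    |∫ x, ⟪u, x⟫ ∂((volume.restrict K).tilted fun x => -V x)| ≤ ‖u‖ * R := by
  have hb : ∀ᵐ x ∂((volume.restrict K).tilted fun x => -V x), ‖⟪u, x⟫‖ ≤ ‖u‖ * R := by
    filter_upwards [ae_mem_windowTilted (V := V) hKm] with x hx
    have hxR : ‖x‖ ≤ R := by simpa [Metric.mem_closedBall, dist_zero_right] using hKR hx
    exact (norm_inner_le_norm u x).trans (mul_le_mul_of_nonneg_left hxR (norm_nonneg _))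
  have h := norm_integral_le_of_norm_le_const hb
  rw [Real.norm_eq_abs] at h
  refine h.trans ?_
  have h1 : ((volume.restrict K).tilted fun x : EuclideanSpace ℝ (Fin n) => -V x).real Set.univ ≤ 1 :=
    ENNReal.toReal_le_of_le_ofReal zero_le_one (by simpa using prob_le_one)
  exact mul_le_of_le_one_right (mul_nonneg (norm_nonneg _) hR) h1

/-- **THE WINDOWED CONVEXITY ROAD, CENTRING BY SUPPORT.**  `K` convex, measurable, `K ⊆ B̄(0,R)` (`R ≥ 0`); `V` continuous and
`λ`-uniformly convex ON `K`; `q_k ≥ 0`.  Then `∫_K e^{−V} ≤ exp(Σ_k q_k·(λ⁻¹ + R²)·‖u_k‖²) · ∫_K e^{−(V + Σ_k q_k⟪u_k,·⟫²)}` — the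
bounded-window END of `…ConvexWindowTiltMoment` with `m_k² ≤ ‖u_k‖²R²`; the window's radius is the only new letter (TRUE; a
MODEL-window device — at print's window `λR²` is dead by value, refuter E-ne7bref-g71-3 ∕ F449 ∕ F454 ∕ F455; the road print can
afford is §3 ∕ `…ConvexWindowVirialSocket`). [folklore] -/
theorem exp_moment_le_of_uniformlyConvex_on_convexWindow_subset_closedBall {V : EuclideanSpace ℝ (Fin n) → ℝ} {lam R : ℝ}
    {r : ℕ} {K : Set (EuclideanSpace ℝ (Fin n))} (hlam : 0 < lam) (hK : Convex ℝ K) (hKm : MeasurableSet K)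
    (hKR : K ⊆ Metric.closedBall (0 : EuclideanSpace ℝ (Fin n)) R) (hR : 0 ≤ R) (hVc : Continuous V)
    (hV : ∀ x ∈ K, ∀ y ∈ K, V x + ⟪gradient V x, y - x⟫ + lam / 2 * ‖y - x‖ ^ 2 ≤ V y)
    (q : Fin r → ℝ) (hq : ∀ k, 0 ≤ q k) (u : Fin r → EuclideanSpace ℝ (Fin n)) :
    ∫ x in K, exp (-V x) ≤ exp (∑ k, q k * ((lam⁻¹ + R ^ 2) * ‖u k‖ ^ 2)) * ∫ x in K, exp (-(V x + ∑ k, q k * ⟪u k, x⟫ ^ 2)) := by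
  have hKb : Bornology.IsBounded K := Metric.isBounded_closedBall.subset hKR
  refine (exp_moment_le_of_uniformlyConvex_on_boundedConvexWindow hlam hK hKm hKb hVc hV q hq u).trans
    (mul_le_mul_of_nonneg_right (exp_le_exp.2 (Finset.sum_le_sum fun k _ => mul_le_mul_of_nonneg_left ?_ (hq k)))
      (integral_nonneg fun _ => (exp_pos _).le))
  have hm := abs_windowTiltedMean_inner_le_of_subset_closedBall (V := V) hKm hKR hR (u k)
  have hsq : (∫ x, ⟪u k, x⟫ ∂((volume.restrict K).tilted fun x => -V x)) ^ 2 ≤ (‖u k‖ * R) ^ 2 := by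
    rw [← sq_abs]
    exact pow_le_pow_left₀ (abs_nonneg _) hm 2
  nlinarith [hsq]

/-! ## §2 Centring BY THE VIRIAL INEQUALITY: the windowed mean vector and Bessel -/

/-- `‖∫ f dν‖² ≤ ∫ ‖f‖² dν` for a probability measure `ν` (norm of the integral, then the variance is non-negative). [folklore] -/
theorem norm_sq_integral_le_integral_norm_sq {X : Type*} [MeasurableSpace X] (ν : Measure X) [IsProbabilityMeasure ν]
    {f : X → EuclideanSpace ℝ (Fin n)} (h1 : Integrable f ν) (h2 : Integrable (fun x => ‖f x‖ ^ 2) ν) :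
    ‖∫ x, f x ∂ν‖ ^ 2 ≤ ∫ x, ‖f x‖ ^ 2 ∂ν :=
  calc ‖∫ x, f x ∂ν‖ ^ 2 ≤ (∫ x, ‖f x‖ ∂ν) ^ 2 :=
        pow_le_pow_left₀ (norm_nonneg _) (norm_integral_le_integral_norm _) 2
    _ ≤ ∫ x, ‖f x‖ ^ 2 ∂ν := sq_integral_le_integral_sq ν h1.norm h2

/-- **THE WINDOWED MEAN VECTOR IS SHORT**: `K` convex, bounded, measurable, of positive volume, `0 ∈ K`; `V ∈ C¹`, `λ`-uniformly convex
ON `K`, `0 ≤ ⟪∇V 0, y⟫` on `K`: `‖∫ y dν_{V,K}‖² ≤ n∕λ`. [folklore] -/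
theorem norm_sq_windowTiltedMean_le {V : EuclideanSpace ℝ (Fin n) → ℝ} {lam : ℝ} {K : Set (EuclideanSpace ℝ (Fin n))}
    (hlam : 0 < lam) (hK : Convex ℝ K) (hKm : MeasurableSet K) (hKb : Bornology.IsBounded K)
    (hK0 : volume K ≠ 0) (h0 : (0 : EuclideanSpace ℝ (Fin n)) ∈ K) (hV1 : ContDiff ℝ 1 V)
    (hV : ∀ x ∈ K, ∀ y ∈ K, V x + ⟪gradient V x, y - x⟫ + lam / 2 * ‖y - x‖ ^ 2 ≤ V y)
    (hcrit : ∀ y ∈ K, 0 ≤ ⟪gradient V 0, y⟫) :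
    ‖∫ y, y ∂((volume.restrict K).tilted fun x => -V x)‖ ^ 2 ≤ n / lam := by
  haveI : NeZero (volume.restrict K : Measure (EuclideanSpace ℝ (Fin n))) :=
    ⟨fun h => hK0 (Measure.restrict_eq_zero.1 h)⟩
  haveI : IsProbabilityMeasure ((volume.restrict K).tilted fun x : EuclideanSpace ℝ (Fin n) => -V x) :=
    isProbabilityMeasure_tilted (integrableOn_exp_neg_of_isBounded hKb hV1.continuous)
  have h1 : Integrable (fun y : EuclideanSpace ℝ (Fin n) => y) ((volume.restrict K).tilted fun x => -V x) := by
    rw [integrable_tilted_iff (integrableOn_exp_neg_of_isBounded hKb hV1.continuous)]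
    exact ((hV1.continuous.neg.rexp.smul continuous_id).continuousOn.integrableOn_compact
      hKb.isCompact_closure).mono_set subset_closure
  have h2 : Integrable (fun y : EuclideanSpace ℝ (Fin n) => ‖y‖ ^ 2) ((volume.restrict K).tilted fun x => -V x) :=
    integrable_windowTilted_of_isBounded hKb hV1.continuous (continuous_norm.pow 2)
  exact (norm_sq_integral_le_integral_norm_sq _ h1 h2).trans
    (integral_norm_sq_windowTilted_le hlam hK hKm hKb hK0 h0 hV1 hV hcrit)

/-- **BESSEL ON THE WINDOWED TILTED MEANS**: for ORTHONORMAL `u_k` and weights `0 ≤ q_k ≤ q_max`, under the hypotheses of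
`norm_sq_windowTiltedMean_le` (`q_max ≥ 0`): `Σ_k q_k·(∫⟪u_k,y⟫ dν_{V,K})² ≤ q_max·n∕λ`. [folklore] -/
theorem sum_mul_sq_windowTiltedMean_le_of_orthonormal {V : EuclideanSpace ℝ (Fin n) → ℝ} {lam qm : ℝ} {r : ℕ}
    {K : Set (EuclideanSpace ℝ (Fin n))} (hlam : 0 < lam) (hK : Convex ℝ K) (hKm : MeasurableSet K)
    (hKb : Bornology.IsBounded K) (hK0 : volume K ≠ 0) (h0 : (0 : EuclideanSpace ℝ (Fin n)) ∈ K) (hV1 : ContDiff ℝ 1 V)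
    (hV : ∀ x ∈ K, ∀ y ∈ K, V x + ⟪gradient V x, y - x⟫ + lam / 2 * ‖y - x‖ ^ 2 ≤ V y)
    (hcrit : ∀ y ∈ K, 0 ≤ ⟪gradient V 0, y⟫) (q : Fin r → ℝ) (hqm0 : 0 ≤ qm) (hqm : ∀ k, q k ≤ qm)
    (u : Fin r → EuclideanSpace ℝ (Fin n)) (hu : Orthonormal ℝ u) :
    ∑ k, q k * (∫ y, ⟪u k, y⟫ ∂((volume.restrict K).tilted fun x => -V x)) ^ 2 ≤ qm * (n / lam) := by
  set ν : Measure (EuclideanSpace ℝ (Fin n)) := (volume.restrict K).tilted fun x => -V x with hν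
  have h1 : Integrable (fun y : EuclideanSpace ℝ (Fin n) => y) ν :=
    ((hV1.continuous.neg.rexp.smul continuous_id).continuousOn.integrableOn_compact hKb.isCompact_closure).mono_set
      subset_closure |> fun h => (integrable_tilted_iff (integrableOn_exp_neg_of_isBounded hKb hV1.continuous) _).2 h
  set m : EuclideanSpace ℝ (Fin n) := ∫ y, y ∂ν with hm
  have hmk : ∀ k, ∫ y, ⟪u k, y⟫ ∂ν = ⟪u k, m⟫ := fun k => integral_inner h1 (u k)
  simp_rw [hmk]
  have hB : ∑ k, ⟪u k, m⟫ ^ 2 ≤ ‖m‖ ^ 2 := by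
    have := hu.sum_inner_products_le (s := Finset.univ) (x := m)
    simpa only [Real.norm_eq_abs, sq_abs] using this
  calc ∑ k, q k * ⟪u k, m⟫ ^ 2 ≤ ∑ k, qm * ⟪u k, m⟫ ^ 2 :=
        Finset.sum_le_sum fun k _ => mul_le_mul_of_nonneg_right (hqm k) (sq_nonneg _)
    _ = qm * ∑ k, ⟪u k, m⟫ ^ 2 := by rw [Finset.mul_sum]
    _ ≤ qm * ‖m‖ ^ 2 := mul_le_mul_of_nonneg_left hB hqm0
    _ ≤ qm * (n / lam) := mul_le_mul_of_nonneg_left (norm_sq_windowTiltedMean_le hlam hK hKm hKb hK0 h0 hV1 hV hcrit) hqm0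

/-! ## §3 The END: the windowed road for orthonormal directions, centring discharged by the virial inequality -/

/-- **THE WINDOWED CONVEXITY ROAD, CENTRING DISCHARGED (orthonormal directions).**  `K` convex, bounded, measurable with `0 ∈ K`;
`V ∈ C¹`, `λ`-uniformly convex ON `K` in the first-order sense, with the variational letter `0 ≤ ⟪∇V 0, y⟫` on `K` (e.g. `∇V 0 = 0`);
`u` ORTHONORMAL, `0 ≤ q_k ≤ q_max`.  Then
`∫_K e^{−V} ≤ exp((Σ_k q_k + n·q_max)∕λ) · ∫_K e^{−(V + Σ_k q_k⟪u_k,·⟫²)}` — `(tr Q + n‖Q‖)∕λ`, nothing else displayed. [folklore] -/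
theorem exp_moment_le_of_uniformlyConvex_on_boundedConvexWindow_orthonormal {V : EuclideanSpace ℝ (Fin n) → ℝ} {lam qm : ℝ}
    {r : ℕ} {K : Set (EuclideanSpace ℝ (Fin n))} (hlam : 0 < lam) (hK : Convex ℝ K) (hKm : MeasurableSet K)
    (hKb : Bornology.IsBounded K) (h0 : (0 : EuclideanSpace ℝ (Fin n)) ∈ K) (hV1 : ContDiff ℝ 1 V)
    (hV : ∀ x ∈ K, ∀ y ∈ K, V x + ⟪gradient V x, y - x⟫ + lam / 2 * ‖y - x‖ ^ 2 ≤ V y)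
    (hcrit : ∀ y ∈ K, 0 ≤ ⟪gradient V 0, y⟫) (q : Fin r → ℝ) (hq : ∀ k, 0 ≤ q k) (hqm0 : 0 ≤ qm)
    (hqm : ∀ k, q k ≤ qm) (u : Fin r → EuclideanSpace ℝ (Fin n)) (hu : Orthonormal ℝ u) :
    ∫ x in K, exp (-V x) ≤ exp ((∑ k, q k + n * qm) / lam) * ∫ x in K, exp (-(V x + ∑ k, q k * ⟪u k, x⟫ ^ 2)) := by
  by_cases hK0 : volume K = 0
  · have h0m : (volume.restrict K : Measure (EuclideanSpace ℝ (Fin n))) = 0 := Measure.restrict_eq_zero.2 hK0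
    rw [h0m, integral_zero_measure, integral_zero_measure, mul_zero]
  refine (exp_moment_le_of_uniformlyConvex_on_boundedConvexWindow hlam hK hKm hKb hV1.continuous hV q hq u).trans
    (mul_le_mul_of_nonneg_right (exp_le_exp.2 ?_) (integral_nonneg fun _ => (exp_pos _).le))
  have hsplit : ∑ k, q k * (lam⁻¹ * ‖u k‖ ^ 2 + (∫ x, ⟪u k, x⟫ ∂((volume.restrict K).tilted fun x => -V x)) ^ 2) =
      lam⁻¹ * ∑ k, q k + ∑ k, q k * (∫ x, ⟪u k, x⟫ ∂((volume.restrict K).tilted fun x => -V x)) ^ 2 := by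
    rw [Finset.mul_sum, ← Finset.sum_add_distrib]
    refine Finset.sum_congr rfl fun k _ => ?_
    rw [hu.1 k]
    ring
  rw [hsplit]
  have hm := sum_mul_sq_windowTiltedMean_le_of_orthonormal hlam hK hKm hKb hK0 h0 hV1 hV hcrit q hqm0 hqm u hu
  have e : (∑ k, q k + n * qm) / lam = lam⁻¹ * ∑ k, q k + qm * (n / lam) := by
    rw [add_div]
    ring
  rw [e]
  linarith


/-! ## §4 The END from PRIMITIVE constants: coercive quadratic form + anharmonic remainder on a window inside `B̄(0,ρ)` -/

/-- **THE WINDOWED CONVEXITY ROAD FROM PRIMITIVE CONSTANTS.**  `K` convex, measurable, `0 ∈ K ⊆ B̄(0, ρ)`; `A` symmetric with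
`⟪v, Av⟫ ≥ σ‖v‖²`; `P ∈ C³` anharmonic (`D²P(0) = 0`) with `‖D³P(x)‖ ≤ c₃` on `K` and `c₃ρ < 2σ`; `q_k ≥ 0`.  Then, for `V = ⟪·, A·⟫ + P`,
`∫_K e^{−V} ≤ exp(Σ_k q_k·((2σ − c₃ρ)⁻¹ + ρ²)·‖u_k‖²) · ∫_K e^{−(V + Σ_k q_k⟪u_k,·⟫²)}` — the modulus from `…ConvexWindowSuppliers`
(`λ = 2σ − c₃ρ` ON `K`), the centring by support (§1: MODEL windows — at print's radius the `ρ²` summand is dead by value, refuter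
F454 ∕ F455; the (A3) END is `…ConvexWindowVirialSocket`'s); THREE numbers `σ, c₃, ρ` and the weights, nothing else displayed. [folklore] -/
theorem exp_moment_le_of_quadratic_add_anharmonic_on_convexWindow {P : EuclideanSpace ℝ (Fin n) → ℝ} {σ c₃ ρ : ℝ} {r : ℕ}
    {K : Set (EuclideanSpace ℝ (Fin n))} (A : EuclideanSpace ℝ (Fin n) →L[ℝ] EuclideanSpace ℝ (Fin n))
    (hK : Convex ℝ K) (hKm : MeasurableSet K) (h0 : (0 : EuclideanSpace ℝ (Fin n)) ∈ K)
    (hKρ : K ⊆ Metric.closedBall (0 : EuclideanSpace ℝ (Fin n)) ρ)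
    (hA : ∀ v w : EuclideanSpace ℝ (Fin n), ⟪A v, w⟫ = ⟪v, A w⟫) (hσ : ∀ v : EuclideanSpace ℝ (Fin n), σ * ‖v‖ ^ 2 ≤ ⟪v, A v⟫)
    (hP : ContDiff ℝ 3 P) (hP2 : iteratedFDeriv ℝ 2 P 0 = 0) (hP3 : ∀ x ∈ K, ‖iteratedFDeriv ℝ 3 P x‖ ≤ c₃) (hgap : c₃ * ρ < 2 * σ)
    (q : Fin r → ℝ) (hq : ∀ k, 0 ≤ q k) (u : Fin r → EuclideanSpace ℝ (Fin n)) :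
    ∫ x in K, exp (-(⟪x, A x⟫ + P x)) ≤
      exp (∑ k, q k * (((2 * σ - c₃ * ρ)⁻¹ + ρ ^ 2) * ‖u k‖ ^ 2)) *
        ∫ x in K, exp (-((⟪x, A x⟫ + P x) + ∑ k, q k * ⟪u k, x⟫ ^ 2)) := by
  have hρ : 0 ≤ ρ := by simpa [Metric.mem_closedBall, dist_zero_right] using hKρ h0
  have hVc : Continuous fun x : EuclideanSpace ℝ (Fin n) => ⟪x, A x⟫ + P x :=
    (continuous_id.inner A.continuous).add hP.continuous
  exact exp_moment_le_of_uniformlyConvex_on_convexWindow_subset_closedBall (V := fun x => ⟪x, A x⟫ + P x) (sub_pos.2 hgap) hK hKm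
    hKρ hρ hVc (firstOrderOn_quadratic_add_of_thirdDeriv_anharmonic A hK h0 hKρ hA hσ hP hP2 hP3) q hq u


/-- The primitive-constants carrier `∫_K e^{−V} ∕ ∫_K e^{−(V+g)}`, `V = ⟪x,Ax⟫ + P`, is at most `exp(B·((2σ − c₃ρ)⁻¹ + ρ²))` once
`Σ_k q_k‖u_k‖² ≤ B`. [folklore] -/
theorem anharmonicWindowCarrier_le {P : EuclideanSpace ℝ (Fin n) → ℝ} {σ c₃ ρ B : ℝ} {r : ℕ}
    {K : Set (EuclideanSpace ℝ (Fin n))} (A : EuclideanSpace ℝ (Fin n) →L[ℝ] EuclideanSpace ℝ (Fin n))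
    (hK : Convex ℝ K) (hKm : MeasurableSet K) (h0 : (0 : EuclideanSpace ℝ (Fin n)) ∈ K)
    (hKρ : K ⊆ Metric.closedBall (0 : EuclideanSpace ℝ (Fin n)) ρ)
    (hA : ∀ v w : EuclideanSpace ℝ (Fin n), ⟪A v, w⟫ = ⟪v, A w⟫) (hσ : ∀ v : EuclideanSpace ℝ (Fin n), σ * ‖v‖ ^ 2 ≤ ⟪v, A v⟫)
    (hP : ContDiff ℝ 3 P) (hP2 : iteratedFDeriv ℝ 2 P 0 = 0) (hP3 : ∀ x ∈ K, ‖iteratedFDeriv ℝ 3 P x‖ ≤ c₃) (hgap : c₃ * ρ < 2 * σ)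
    (q : Fin r → ℝ) (hq : ∀ k, 0 ≤ q k) (u : Fin r → EuclideanSpace ℝ (Fin n)) (hB : ∑ k, q k * ‖u k‖ ^ 2 ≤ B) :
    (∫ x in K, exp (-(⟪x, A x⟫ + P x))) / (∫ x in K, exp (-((⟪x, A x⟫ + P x) + ∑ k, q k * ⟪u k, x⟫ ^ 2))) ≤
      exp (B * ((2 * σ - c₃ * ρ)⁻¹ + ρ ^ 2)) := by
  refine div_le_of_le_mul₀ (integral_nonneg fun _ => (exp_pos _).le) (exp_pos _).le ?_
  refine (exp_moment_le_of_quadratic_add_anharmonic_on_convexWindow A hK hKm h0 hKρ hA hσ hP hP2 hP3 hgap q hq u).trans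
    (mul_le_mul_of_nonneg_right (exp_le_exp.2 ?_) (integral_nonneg fun _ => (exp_pos _).le))
  have hc : 0 ≤ (2 * σ - c₃ * ρ)⁻¹ + ρ ^ 2 := add_nonneg (inv_nonneg.2 (sub_pos.2 hgap).le) (sq_nonneg _)
  have e : ∑ k, q k * (((2 * σ - c₃ * ρ)⁻¹ + ρ ^ 2) * ‖u k‖ ^ 2) = ((2 * σ - c₃ * ρ)⁻¹ + ρ ^ 2) * ∑ k, q k * ‖u k‖ ^ 2 := by
    rw [Finset.mul_sum]
    exact Finset.sum_congr rfl fun k _ => by ring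
  rw [e, mul_comm B]
  exact mul_le_mul_of_nonneg_left hB hc

/-! ## §5 The junction: `LocCondStability` BY NAME for the support-centred primitive-constants carrier (MODEL windows) -/

section Junction

variable {Pt : Type} [DecidableEq Pt] {C : ℕ → Type} {𝒢 : (j : ℕ) → GoodClass (C j)}

/-- **LCS FOR THE ANHARMONIC WINDOWED CARRIER FROM PRIMITIVE CONSTANTS, ON THE SUPPORT.**  At every pattern prefix `g` of a level
`j < K` and background `y` let `M j g y = ∫_{Kw} e^{−V} ∕ ∫_{Kw} e^{−(V+g)}` with `V = ⟪x, A x⟫ + P` for the data at `(j, g, y)` on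
`EuclideanSpace ℝ (Fin (n j g))` — window `Kw j g y`, operator `A j g y`, anharmonic remainder `P j g y`, weights ∕ directions `q, u`
—; suppose `M j g` is a.e.-strongly measurable and ON THE SUPPORT OF THE TERM: `Kw` convex measurable with `0 ∈ Kw ⊆ B̄(0, ρ j g)`,
`A` symmetric and `σ j g`-coercive, `P ∈ C³` with `D²P(0) = 0` and `‖D³P‖ ≤ c₃ j g` on `Kw`, `c₃ρ < 2σ`, `q ≥ 0`, and the trace letter
`Σ_k q_k‖u_k‖² ≤ B j g` — the FOUR numbers `σ, c₃, ρ, B` y-UNIFORM.  Then `LocCondStability T S K μ ρ₀ M b` with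
`b j g = B j g·((2σ j g − c₃ j g·ρ j g)⁻¹ + (ρ j g)²)`, integrability conjunct included.  (The SUPPORT-CENTRED socket: MODEL windows
only — at print's radius the `B·ρ²` summand is dead by value, refuter F454 ∕ F455; the (A3) socket is
`…ConvexWindowVirialSocket.locCondStability_of_hessianSmallWindowCarrier_on_support`.) [folklore] -/
theorem locCondStability_of_anharmonicWindowCarrier_on_support (T : Tower Pt C 𝒢) (Spat : (j : ℕ) → (Fin j → Pt) → Finset Pt)
    (K : ℕ) [∀ j, MeasurableSpace (C j)] (μ : (j : ℕ) → Measure (C j)) (ρ₀ : C 0 → ℝ)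
    (M : (j : ℕ) → (Fin j → Pt) → C j → ℝ)
    (n r : (j : ℕ) → (Fin j → Pt) → ℕ)
    (Kw : (j : ℕ) → (g : Fin j → Pt) → C j → Set (EuclideanSpace ℝ (Fin (n j g))))
    (A : (j : ℕ) → (g : Fin j → Pt) → C j → (EuclideanSpace ℝ (Fin (n j g)) →L[ℝ] EuclideanSpace ℝ (Fin (n j g))))
    (P : (j : ℕ) → (g : Fin j → Pt) → C j → EuclideanSpace ℝ (Fin (n j g)) → ℝ)
    (q : (j : ℕ) → (g : Fin j → Pt) → C j → Fin (r j g) → ℝ)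
    (u : (j : ℕ) → (g : Fin j → Pt) → C j → Fin (r j g) → EuclideanSpace ℝ (Fin (n j g)))
    (σ c₃ ρ B : (j : ℕ) → (Fin j → Pt) → ℝ) (hρ : (𝒢 0).Gd ρ₀) (h0 : ∀ x, 0 ≤ ρ₀ x)
    (hM : ∀ j g, j < K → g ∈ admS T Spat j → ∀ y, M j g y =
      (∫ x in Kw j g y, exp (-(⟪x, A j g y x⟫ + P j g y x))) /
        ∫ x in Kw j g y, exp (-((⟪x, A j g y x⟫ + P j g y x) + ∑ k, q j g y k * ⟪u j g y k, x⟫ ^ 2)))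
    (hMm : ∀ j g, j < K → g ∈ admS T Spat j → AEStronglyMeasurable (M j g) (μ j))
    (hKc : ∀ j g, j < K → g ∈ admS T Spat j → ∀ y, T.eterm ρ₀ j g y ≠ 0 → Convex ℝ (Kw j g y))
    (hKm : ∀ j g, j < K → g ∈ admS T Spat j → ∀ y, T.eterm ρ₀ j g y ≠ 0 → MeasurableSet (Kw j g y))
    (hK0 : ∀ j g, j < K → g ∈ admS T Spat j → ∀ y, T.eterm ρ₀ j g y ≠ 0 → (0 : EuclideanSpace ℝ (Fin (n j g))) ∈ Kw j g y)
    (hKρ : ∀ j g, j < K → g ∈ admS T Spat j → ∀ y, T.eterm ρ₀ j g y ≠ 0 →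
      Kw j g y ⊆ Metric.closedBall (0 : EuclideanSpace ℝ (Fin (n j g))) (ρ j g))
    (hA : ∀ j g, j < K → g ∈ admS T Spat j → ∀ y, T.eterm ρ₀ j g y ≠ 0 →
      ∀ v w : EuclideanSpace ℝ (Fin (n j g)), ⟪A j g y v, w⟫ = ⟪v, A j g y w⟫)
    (hσ : ∀ j g, j < K → g ∈ admS T Spat j → ∀ y, T.eterm ρ₀ j g y ≠ 0 →
      ∀ v : EuclideanSpace ℝ (Fin (n j g)), σ j g * ‖v‖ ^ 2 ≤ ⟪v, A j g y v⟫)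
    (hP : ∀ j g, j < K → g ∈ admS T Spat j → ∀ y, T.eterm ρ₀ j g y ≠ 0 → ContDiff ℝ 3 (P j g y))
    (hP2 : ∀ j g, j < K → g ∈ admS T Spat j → ∀ y, T.eterm ρ₀ j g y ≠ 0 → iteratedFDeriv ℝ 2 (P j g y) 0 = 0)
    (hP3 : ∀ j g, j < K → g ∈ admS T Spat j → ∀ y, T.eterm ρ₀ j g y ≠ 0 →
      ∀ x ∈ Kw j g y, ‖iteratedFDeriv ℝ 3 (P j g y) x‖ ≤ c₃ j g)
    (hgap : ∀ j g, j < K → g ∈ admS T Spat j → c₃ j g * ρ j g < 2 * σ j g)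
    (hq : ∀ j g, j < K → g ∈ admS T Spat j → ∀ y k, 0 ≤ q j g y k)
    (hB : ∀ j g, j < K → g ∈ admS T Spat j → ∀ y, T.eterm ρ₀ j g y ≠ 0 → ∑ k, q j g y k * ‖u j g y k‖ ^ 2 ≤ B j g)
    (hint : ∀ j g, j < K → g ∈ admS T Spat j → Integrable (T.eterm ρ₀ j g) (μ j)) :
    LocCondStability T Spat K μ ρ₀ M (fun j g => B j g * ((2 * σ j g - c₃ j g * ρ j g)⁻¹ + ρ j g ^ 2)) := by
  refine locCondStability_of_carrier_le_on_support T Spat K μ ρ₀ M _ hρ h0 hMm (fun j g hj hg y => ?_)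
    (fun j g hj hg y hy => ?_) hint
  · rw [hM j g hj hg y]
    exact div_nonneg (integral_nonneg fun _ => (exp_pos _).le) (integral_nonneg fun _ => (exp_pos _).le)
  · rw [hM j g hj hg y]
    exact anharmonicWindowCarrier_le (A j g y) (hKc j g hj hg y hy) (hKm j g hj hg y hy) (hK0 j g hj hg y hy) (hKρ j g hj hg y hy)
      (hA j g hj hg y hy) (hσ j g hj hg y hy) (hP j g hj hg y hy) (hP2 j g hj hg y hy) (hP3 j g hj hg y hy) (hgap j g hj hg)
      _ (hq j g hj hg y) _ (hB j g hj hg y hy)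

end Junction

end Summit.QuantumFields.BalabanUV.T4Continuum.NE7b.ConvexWindowTiltCentred

end
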